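import Summits.ResolutionOfSingularities.ResolutionOfSingularities.Theorems.FrobeniusClosingSteerBetaNewtonStrictTransform
import Summits.ResolutionOfSingularities.ResolutionOfSingularities.Theorems.FrobeniusClosingSteerBetaCleaningTransfer
import Summits.ResolutionOfSingularities.ResolutionOfSingularities.Theorems.FrobeniusClosingSteerBetaLetterWords
import HarnessLib

/-!
# Crux `Steer` (stmt-ResolutionOfSingularities-16345), chain W4.1, β-LEAF, K-β2♭ part (II), file 7: the PREPAREDNESS TRANSFER
# along the `y`-chart letter — res-L0-w41-idea-1's `PreparedTransferYHat` with the SQUARE-FREE twist repair (def-free)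

OURS (campaign `res-hironaka`, rung L ★L-G4, slot W4.1; statements about the route's own objects; they replace the
role of no printed item and are NOT statements of the manuscript under review [claim: Hironaka2017, status:
under-review]; AI review is weaker than expert review). Seat res-D-pv-003 (gen 7), K-β2♭ kernel owner (res-L0-w41-plan-1
RULINGS 143/150 (2)/181b).

**`preparedTransferY`** — CJS Lemma 12.2 (4) modulo `u`-squares, in the binder shape of res-L0-w41-idea-1's β-leaf v18.4 word
`PreparedTransferYHat` (`L/res-L0-w41-idea-1/Sketch-idea-1-v18-hatleaf.lean` l.442–450) with ONE repair (res-D-pv-003 FINDING J4,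
STATUS 2026-08-27T16:14Z: the word is false at a non-square-free twist, witness `u = x²y³`, `f = Ψ + x²yz²`): the `y`-exponent of the
twist is `≤ 1`. Along the `y`-chart letter (`φ x = φ y · x₁`, `φ z = φ y · z₁`, `φ w = φ y · w₁`, residue fields identified) between
arithmetic stages (cone clauses with ROOTLESS residue forms, radicand relation `φ (u · f) = (φ y)^(2k) · (u₁ · f₁)`), a representative
PREPARED at its left vertex `(α, β)` modulo `u`-squares (`AlphaGe`, `BetaGe`, no cleaning and no integral move + cleaning reaches
`BetaGt`) transforms to one prepared at `(α, α + β − 1)` modulo `u₁`-squares. The conclusion is literally the body of idea-1's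
`IsPreparedTwAt u₁ x₁ (φ y) z₁ w₁ d α (α + β − 1) f₁` (with `IsDissolvableTwAt` unfolded). Hypotheses are a SUBSET of the word's
(`IsHatRing`: regular, dimension four, perfect residue field — completeness is not used; `IsYChartHat`: the substitution equalities
and the surjectivity of `κ → κ₁`; `IsArithStage`: the cone clauses and the twists). Route: `…BetaNewtonSupport` (words on `𝐒(f)`),
`…BetaNewtonTransport` (Prop. 2.6 transport, vertex transport), `…BetaNewtonStrictTransform` (`φ f = (φ y)^d f₁`),
`…BetaSquareVisibility` + `…BetaVertexMoves` + `…BetaCleaningTransfer` (cleanings lift), and res-D-pv-003's (I-Y)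
`BetaLetter.yLetterPush` (p544593) for the positive thresholds.

[cite: CossartJannsenSaito2020, Lemma 12.2] [cite: CossartPiltant2019, Prop. 2.1 and 2.6] No Theses file is imported; nothing
here is a route item or a registration.
-/

noncomputable section

-- `Summit.<S>.<S>.…` duplicates the summit name by design (single-problem summit).
set_option linter.dupNamespace false

namespace Summit.ResolutionOfSingularities.ResolutionOfSingularities.Theorems.SwitchingDichotomy.BetaNewton

open IsLocalRing nonZeroDivisors
open Literature.AlgebraicGeometry.Resolution
open Literature.AlgebraicGeometry.Resolution.CossartPiltant (uPow minExponents)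
open Summit.ResolutionOfSingularities.ResolutionOfSingularities.Theorems.SwitchingDichotomy.BetaPolygon
open Summit.ResolutionOfSingularities.ResolutionOfSingularities.Theorems.SwitchingDichotomy.BetaPolygonMoves (betaGe_move_iff)
open Summit.ResolutionOfSingularities.ResolutionOfSingularities.Theorems.SwitchingDichotomy.BetaLetter (yLetterPush)

variable {S S₁ : Type} [CommRing S] [CommRing S₁]

/-! ## §1 The cone clause puts `f` in `𝔪^d` -/

/-- The cone clause `f ≡ Ψ(z, w) (mod (x, y)·𝔪^(d−1) + 𝔪^(d+1))`, `Ψ` a form of degree `d ≥ 1`, puts `f` in `𝔪^d`. [folklore] -/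
theorem mem_pow_of_cone [IsLocalRing S] {x y z w f : S} (hspan : Ideal.span {x, y, z, w} = maximalIdeal S) {d : ℕ}
    (hd : 0 < d) {Ψ : MvPolynomial (Fin 2) S} (hΨ : Ψ.IsHomogeneous d)
    (hf : f - MvPolynomial.eval ![z, w] Ψ ∈ Ideal.span {x, y} * maximalIdeal S ^ (d - 1) ⊔ maximalIdeal S ^ (d + 1)) :
    f ∈ maximalIdeal S ^ d := by
  have hzw : Ideal.span (Set.range ![z, w]) ≤ maximalIdeal S := by
    rw [← hspan, Ideal.span_le]
    rintro _ ⟨i, rfl⟩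
    fin_cases i <;> exact Ideal.subset_span (by simp)
  have hΨm : MvPolynomial.eval ![z, w] Ψ ∈ maximalIdeal S ^ d :=
    Ideal.pow_right_mono hzw d ((Ideal.mem_span_pow_iff_exists_isHomogeneous ![z, w] _).mpr ⟨Ψ, hΨ, rfl⟩)
  have hxy : Ideal.span ({x, y} : Set S) ≤ maximalIdeal S := by
    rw [← hspan]; exact Ideal.span_mono (by intro t ht; simp only [Set.mem_insert_iff, Set.mem_singleton_iff] at ht ⊢; tauto)
  have hle : Ideal.span {x, y} * maximalIdeal S ^ (d - 1) ⊔ maximalIdeal S ^ (d + 1) ≤ maximalIdeal S ^ d := by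
    refine sup_le ?_ (Ideal.pow_le_pow_right (Nat.le_succ d))
    calc Ideal.span {x, y} * maximalIdeal S ^ (d - 1) ≤ maximalIdeal S * maximalIdeal S ^ (d - 1) := Ideal.mul_mono_left hxy
      _ = maximalIdeal S ^ d := by rw [← pow_succ', Nat.sub_add_cancel hd]
  have : f = (f - MvPolynomial.eval ![z, w] Ψ) + MvPolynomial.eval ![z, w] Ψ := by ring
  rw [this]
  exact add_mem (hle hf) hΨm

/-! ## §2 The preparedness transfer -/

/-- **PREPAREDNESS TRANSFER along the `y`-chart letter** (res-L0-w41-idea-1's `PreparedTransferYHat`, v18.4, with the square-free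
repair `b ≤ 1` of FINDING J4; CJS Lemma 12.2 (4) modulo `u`-squares): a representative prepared at its left vertex `(α, β)` modulo
`u`-squares upstairs transforms to a representative prepared at `(α, α + β − 1)` modulo `u₁`-squares downstairs. See the module
docstring for the binders. [cite: CossartJannsenSaito2020, Lemma 12.2] [cite: CossartPiltant2019, Prop. 2.6] -/
theorem preparedTransferY [IsLocalRing S] [CharP S 2] [IsLocalRing S₁] [CharP S₁ 2]
    (hreg : IsRegularLocalRing S) (hdim : ringKrullDim S = 4) (hperf : PerfectField (ResidueField S))
    (hreg₁ : IsRegularLocalRing S₁) (hdim₁ : ringKrullDim S₁ = 4)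
    (φ : S →+* S₁) (σ : ResidueField S →+* S) (hsurj : Function.Surjective ((residue S₁).comp (φ.comp σ)))
    {x y z w u f : S} {x₁ z₁ w₁ u₁ f₁ : S₁} {d k a b a₁ b₁ : ℕ} (hd : 0 < d)
    (hspan : Ideal.span {x, y, z, w} = maximalIdeal S) (hu : u = x ^ a * y ^ b) (hbsq : b ≤ 1)
    (hcone : ∃ Ψ : MvPolynomial (Fin 2) S, Ψ.IsHomogeneous d ∧
      (∀ a b : ResidueField S, (a ≠ 0 ∨ b ≠ 0) → MvPolynomial.eval ![a, b] (MvPolynomial.map (residue S) Ψ) ≠ 0) ∧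
      f - MvPolynomial.eval ![z, w] Ψ ∈ Ideal.span {x, y} * maximalIdeal S ^ (d - 1) ⊔ maximalIdeal S ^ (d + 1))
    (hspan₁ : Ideal.span {x₁, φ y, z₁, w₁} = maximalIdeal S₁) (hu₁ : u₁ = x₁ ^ a₁ * φ y ^ b₁)
    (hcone₁ : ∃ Ψ : MvPolynomial (Fin 2) S₁, Ψ.IsHomogeneous d ∧
      (∀ a b : ResidueField S₁, (a ≠ 0 ∨ b ≠ 0) → MvPolynomial.eval ![a, b] (MvPolynomial.map (residue S₁) Ψ) ≠ 0) ∧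
      f₁ - MvPolynomial.eval ![z₁, w₁] Ψ ∈ Ideal.span {x₁, φ y} * maximalIdeal S₁ ^ (d - 1) ⊔ maximalIdeal S₁ ^ (d + 1))
    (hx : φ x = φ y * x₁) (hz : φ z = φ y * z₁) (hw : φ w = φ y * w₁)
    (hrad : φ (u * f) = φ y ^ (2 * k) * (u₁ * f₁))
    {α β : ℚ} (hα : 0 ≤ α) (hβ : 0 ≤ β) (hAl : AlphaGe x z w d α f) (hG : BetaGe x y z w d α β f)
    (hncl : ∀ q : S, ¬ BetaGt x y z w d α β (f + u * q ^ 2))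
    (hnmv : ∀ a b : ℕ, (α = a ∧ β = b) → ∀ c₁ c₂ q : S,
      ¬ BetaGt x y (z + c₁ * x ^ a * y ^ b) (w + c₂ * x ^ a * y ^ b) d α β (f + u * q ^ 2)) :
    0 ≤ α ∧ 0 ≤ α + β - 1 ∧ AlphaGe x₁ z₁ w₁ d α f₁ ∧ BetaGe x₁ (φ y) z₁ w₁ d α (α + β - 1) f₁ ∧
      ¬ BetaGt x₁ (φ y) z₁ w₁ d α (α + β - 1) f₁ ∧
      ¬ ((∃ q : S₁, BetaGt x₁ (φ y) z₁ w₁ d α (α + β - 1) (f₁ + u₁ * q ^ 2)) ∨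
        ∃ a b : ℕ, (α = a ∧ α + β - 1 = b) ∧ ∃ c₁ c₂ q : S₁,
          BetaGt x₁ (φ y) (z₁ + c₁ * x₁ ^ a * φ y ^ b) (w₁ + c₂ * x₁ ^ a * φ y ^ b) d α (α + β - 1)
            (f₁ + u₁ * q ^ 2)) := by
  classical
  haveI := hreg
  haveI := hreg₁
  haveI : IsDomain S₁ := isDomain_of_isRegularLocalRing S₁
  have ht : IsRsopPart ![x, y, z, w] := isRsopPart_four hreg hdim hspan
  have ht' : IsRsopPart ![x₁, φ y, z₁, w₁] := isRsopPart_four hreg₁ hdim₁ hspan₁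
  -- cone data: `f ∈ 𝔪^d`, `f₁ ∈ 𝔪₁^d`, `(0, 0, d, 0)` is a minimal exponent of both
  obtain ⟨Ψ, hΨ, hroot, hfΨ⟩ := hcone
  obtain ⟨Ψ₁, hΨ₁, hroot₁, hfΨ₁⟩ := hcone₁
  have hΨd := coeff_single_notMem_of_rootless hΨ (hroot 1 0 (Or.inl one_ne_zero))
  have hΨ₁d := coeff_single_notMem_of_rootless hΨ₁ (hroot₁ 1 0 (Or.inl one_ne_zero))
  have hfd : f ∈ maximalIdeal S ^ d := mem_pow_of_cone hspan hd hΨ hfΨ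
  have hf₁d : f₁ ∈ maximalIdeal S₁ ^ d := mem_pow_of_cone hspan₁ hd hΨ₁ hfΨ₁
  have hcf := single_two_mem_minExponents_of_cone ht hspan hΨ hΨd hfΨ
  have hcf₁ := single_two_mem_minExponents_of_cone ht' hspan₁ hΨ₁ hΨ₁d hfΨ₁
  -- the strict transform `g` and its identification with `f₁`
  obtain ⟨g, hg⟩ := exists_strictTransform φ hx hz hw (d := d) (f := f) (by rw [hspan]; exact hfd)
  have hgf : g * φ y ^ d = φ f := by rw [hg, mul_comm]
  obtain ⟨-, h2⟩ := minExponents_strictTransform φ ht ht' hspan hspan₁ hx hz hw hfd hgf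
  obtain ⟨ag, hag, hagle⟩ := h2 _ hcf
  obtain ⟨k0, k1, -, -⟩ := (le_transport_iff _ ag d).mp hagle
  have hag0 : ag 0 = 0 := by simpa using k0
  have hag1 : ag 1 = 0 := by simpa using k1
  obtain ⟨hgf₁, ha₁, hk⟩ := strictTransform_eq_of_radicand φ ht' hx hu hu₁ hg hrad hag hag0 hag1 hcf₁ (by simp) (by simp)
  have hf' : φ f = φ y ^ d * f₁ := by rw [hg, hgf₁]
  have hf : f₁ * φ y ^ d = φ f := by rw [hf', mul_comm]
  -- the positive thresholds transfer by the push-forward law (I-Y)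
  have hy0 : φ y ∈ S₁⁰ := mem_nonZeroDivisors_of_ne_zero (by simpa using ht'.ne_zero 1)
  obtain ⟨hAl₁, hBe₁⟩ := yLetterPush hreg hdim hspan φ hy0 hx hz hw hf' hfd
  -- a vertex exponent of `f`: `α + β ≥ 1` and `2α + β ≥ 2`
  have hnI : ¬ BetaGt x y z w d α β f := by simpa using hncl 0
  have hGs := (betaGe_iff_forall_minExponents ht hα hβ f).mp hG
  have hex : ∃ c ∈ minExponents ![x, y, z, w] f,
      ¬ (d ≤ c 2 + c 3 ∨ ⌊α * ((d - c 2 - c 3 : ℕ) : ℚ)⌋₊ + 1 ≤ c 0 ∨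
        (⌈α * ((d - c 2 - c 3 : ℕ) : ℚ)⌉₊ ≤ c 0 ∧ ⌊β * ((d - c 2 - c 3 : ℕ) : ℚ)⌋₊ + 1 ≤ c 1)) := by
    by_contra hne
    push Not at hne
    exact hnI ((betaGt_iff_forall_minExponents ht hα hβ f).mpr hne)
  obtain ⟨av, hav, hPav⟩ := hex
  obtain ⟨hzwv, hav0, hav1⟩ := exponent_eq_of_betaGe_of_not_betaGt hα hβ (hGs av hav) hPav
  have hdegv : d ≤ av 0 + av 1 + av 2 + av 3 := by
    rw [← sum_four]; exact (mem_pow_iff_forall_minExponents ht hspan d f).mp hfd av hav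
  have hαβ : 1 ≤ α + β := add_ge_one_of_vertex hzwv hav0 hav1 hdegv
  obtain ⟨-, htwo⟩ := transport_vertex_mem_minExponents φ ht ht' hspan hspan₁ hx hz hw hfd hf hf₁d hα hβ hG hav
    hzwv hav0 hav1
  have hk' : 2 * k + b₁ = a + b + d := hk
  refine ⟨hα, by linarith, hAl₁ α hα hAl, hBe₁ α β hα hβ hG, ?_, ?_⟩
  · -- not strictly beyond the vertex downstairs: a cleaning `q₁ = 0` would lift
    intro hgt
    obtain ⟨q, hq⟩ := cleaning_transfer hperf φ ht ht' hspan hspan₁ hx hz hw hfd hf hf₁d hα hβ hG hbsq hk'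
      ⟨0, by simpa using hgt⟩
    exact hncl q (by rw [hu]; exact hq)
  · rintro (⟨q₁, hq₁⟩ | ⟨a', b', ⟨hαa, hβb⟩, c₁, c₂, q₁, hq₁⟩)
    · -- a pure cleaning downstairs lifts to a pure cleaning upstairs
      rw [hu₁, ha₁] at hq₁
      obtain ⟨q, hq⟩ := cleaning_transfer hperf φ ht ht' hspan hspan₁ hx hz hw hfd hf hf₁d hα hβ hG hbsq hk'
        ⟨q₁, hq₁⟩
      exact hncl q (by rw [hu]; exact hq)
    · -- a move + cleaning downstairs: lift the move constants through `κ = κ₁`, then lift the cleaning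
      -- the integral vertex upstairs: `α = a'`, `β = b' + 1 − a'`
      have hle : a' ≤ b' + 1 := by
        have : (a' : ℚ) ≤ b' + 1 := by linarith
        exact_mod_cast this
      set bβ : ℕ := b' + 1 - a' with hbβ
      have hβ' : β = (bβ : ℚ) := by
        rw [hbβ, Nat.cast_sub hle]; push_cast; linarith
      have hab' : 1 ≤ a' + b' := by
        have : (1 : ℚ) ≤ a' + b' := by linarith
        exact_mod_cast this
      have habβ : a' + bβ = b' + 1 := by omega
      -- lift the move constants
      obtain ⟨r₁, hr₁⟩ := hsurj (residue S₁ c₁)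
      obtain ⟨r₂, hr₂⟩ := hsurj (residue S₁ c₂)
      simp only [RingHom.comp_apply] at hr₁ hr₂
      have hε₁ : c₁ - φ (σ r₁) ∈ maximalIdeal S₁ := (Ideal.Quotient.mk_eq_mk_iff_sub_mem _ _).mp hr₁.symm
      have hε₂ : c₂ - φ (σ r₂) ∈ maximalIdeal S₁ := (Ideal.Quotient.mk_eq_mk_iff_sub_mem _ _).mp hr₂.symm
      -- the moved frames
      set zu : S := z + σ r₁ * x ^ a' * y ^ bβ with hzu
      set wu : S := w + σ r₂ * x ^ a' * y ^ bβ with hwu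
      set zd : S₁ := z₁ + φ (σ r₁) * (x₁ ^ a' * φ y ^ b') with hzd
      set wd : S₁ := w₁ + φ (σ r₂) * (x₁ ^ a' * φ y ^ b') with hwd
      have hMu : x ^ a' * y ^ bβ ∈ Ideal.span ({x, y} : Set S) := by
        rcases Nat.eq_zero_or_pos a' with ha | ha
        · have hb1 : 1 ≤ bβ := by omega
          obtain ⟨e, he⟩ : ∃ e, bβ = e + 1 := ⟨bβ - 1, by omega⟩
          rw [ha, he, pow_zero, one_mul, pow_succ]
          exact Ideal.mul_mem_left _ _ (Ideal.subset_span (by simp))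
        · obtain ⟨e, he⟩ : ∃ e, a' = e + 1 := ⟨a' - 1, by omega⟩
          rw [he, pow_succ, mul_assoc, mul_comm x, ← mul_assoc]
          exact Ideal.mul_mem_left _ _ (Ideal.subset_span (by simp))
      have hMd : x₁ ^ a' * φ y ^ b' ∈ Ideal.span ({x₁, φ y} : Set S₁) := by
        rcases Nat.eq_zero_or_pos a' with ha | ha
        · obtain ⟨e, he⟩ : ∃ e, b' = e + 1 := ⟨b' - 1, by omega⟩
          rw [ha, he, pow_zero, one_mul, pow_succ]
          exact Ideal.mul_mem_left _ _ (Ideal.subset_span (by simp))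
        · obtain ⟨e, he⟩ : ∃ e, a' = e + 1 := ⟨a' - 1, by omega⟩
          rw [he, pow_succ, mul_assoc, mul_comm x₁, ← mul_assoc]
          exact Ideal.mul_mem_left _ _ (Ideal.subset_span (by simp))
      have hspanu : Ideal.span {x, y, zu, wu} = maximalIdeal S := by
        rw [hzu, hwu, mul_assoc, mul_assoc,
          span_four_move_eq x y z w (Ideal.mul_mem_left _ _ hMu) (Ideal.mul_mem_left _ _ hMu), hspan]
      have hspand : Ideal.span {x₁, φ y, zd, wd} = maximalIdeal S₁ := by
        rw [hzd, hwd, span_four_move_eq x₁ (φ y) z₁ w₁ (Ideal.mul_mem_left _ _ hMd) (Ideal.mul_mem_left _ _ hMd), hspan₁]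
      have htu : IsRsopPart ![x, y, zu, wu] := isRsopPart_four hreg hdim hspanu
      have htd : IsRsopPart ![x₁, φ y, zd, wd] := isRsopPart_four hreg₁ hdim₁ hspand
      have hpow : φ y ^ a' * φ y ^ bβ = φ y * φ y ^ b' := by rw [← pow_add, habβ, pow_succ']
      have hzud : φ zu = φ y * zd := by
        calc φ zu = φ y * z₁ + φ (σ r₁) * x₁ ^ a' * (φ y ^ a' * φ y ^ bβ) := by
              rw [hzu, map_add, map_mul, map_mul, map_pow, map_pow, hx, hz]; ring
          _ = φ y * zd := by rw [hpow, hzd]; ring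
      have hwud : φ wu = φ y * wd := by
        calc φ wu = φ y * w₁ + φ (σ r₂) * x₁ ^ a' * (φ y ^ a' * φ y ^ bβ) := by
              rw [hwu, map_add, map_mul, map_mul, map_pow, map_pow, hx, hw]; ring
          _ = φ y * wd := by rw [hpow, hwd]; ring
      -- `BetaGe` in the moved frame upstairs
      have hGu : BetaGe x y zu wu d α β f := by
        have hmv : ∀ c : S, c * x ^ a' * y ^ bβ ∈
            Ideal.span {x ^ (⌊α⌋₊ + 1)} ⊔ Ideal.span {x ^ ⌈α⌉₊ * y ^ ⌈β⌉₊} := fun c => by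
          rw [hαa, hβ', Nat.ceil_natCast, Nat.ceil_natCast]
          exact Ideal.mem_sup_right (Ideal.mem_span_singleton.mpr ⟨c, by ring⟩)
        exact (betaGe_move_iff x y z w hα β (hmv (σ r₁)) (hmv (σ r₂)) d f).mp hG
      -- the downstairs hypothesis in the frame `(zd, wd)`: the constants differ by elements of `𝔪₁`
      have hq₁' : BetaGt x₁ (φ y) zd wd d α (α + β - 1) (f₁ + x₁ ^ a * φ y ^ b₁ * q₁ ^ 2) := by
        rw [hu₁, ha₁, hβb, hαa] at hq₁
        rw [hβb, hαa]
        have e1 : z₁ + c₁ * x₁ ^ a' * φ y ^ b' = zd + (c₁ - φ (σ r₁)) * (x₁ ^ a' * φ y ^ b') := by rw [hzd]; ring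
        have e2 : w₁ + c₂ * x₁ ^ a' * φ y ^ b' = wd + (c₂ - φ (σ r₂)) * (x₁ ^ a' * φ y ^ b') := by rw [hwd]; ring
        rw [e1, e2] at hq₁
        exact (betaGt_move_maximalIdeal_iff hspand a' b' hab' hε₁ hε₂ d _).mp hq₁
      obtain ⟨q, hq⟩ := cleaning_transfer hperf φ htu htd hspanu hspand hx hzud hwud hfd hf hf₁d hα hβ hGu hbsq hk'
        ⟨q₁, hq₁'⟩
      refine hnmv a' bβ ⟨hαa, hβ'⟩ (σ r₁) (σ r₂) q ?_
      rw [hu]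
      exact hq

end Summit.ResolutionOfSingularities.ResolutionOfSingularities.Theorems.SwitchingDichotomy.BetaNewton

end
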